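import Mathlib
import HarnessLib

/-!
# Flag pivot law: the first negative LDLᵀ pivot of a nested flag IS the first indefinite corner
(pub-rhpf THEORY-4 §10 "object-independent (Fourier-flag) depth", TABLE F; mechanism/rigidity
campaign — no RH claims)

PROVED (kernel) form of the equivalence behind the TABLE F certificate.  Setting (dictionary,
THEOREM-informal): the control's window form on the even Galerkin block is a real symmetric matrix
`Q`; its leading corners `C₁ ⊂ C₂ ⊂ …` are the forms of the smaller windows (the Galerkin spaces are
nested, `PfPersistenceGalerkinNesting`); the native-order `LDLᵀ` pivot of index `m+1` is the scalar
Schur complement `d = c − bᵀ C_m⁻¹ b` of the bordered corner `C_{m+1} = [[C_m, b], [bᵀ, c]]`.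
The job LOCATES the first negative pivot `KF` and CERTIFIES the pair "corner `KF−1` positive definite"
∧ "corner `KF` has a negative eigenvalue"; the theorems below say these are the same event:

* `posSemidef_unit_iff`           : a `1 × 1` real matrix is PSD iff its entry is `≥ 0`;
* `bordered_posSemidef_iff_pivot` : for `A` positive definite, `[[A, b], [bᵀ, c]]` is PSD iff the
                                    pivot `(c − bᵀA⁻¹b) () () ≥ 0` (Mathlib's Schur-complement lemma
                                    `Matrix.PosDef.fromBlocks₁₁` specialised to a one-column border);
* `bordered_not_posSemidef_iff_pivot_neg` : … is NOT PSD iff the pivot is `< 0` — so, given that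
                                    corner `m` is positive definite, "first negative pivot at `m+1`"
                                    ⟺ "corner `m+1` is the first indefinite corner" (`N* = KF − 1`);
* `bordered_det_eq`               : `det [[A, b], [bᵀ, c]] = det A · pivot`, hence with `det A > 0`
                                    the pivot has the sign of the bordered determinant
                                    (`pivot_neg_iff_det_neg`);
* `crossTerm_law`                 : the arithmetic behind the "cross-term cancellation" reading of
                                    §9.5 (b): if `q_in ≥ 0`, `q_out ≥ 0` and `q_in + q_out + 2c < 0`
                                    then `c < 0` and `q_in · q_out < c²` (the `2 × 2` Gram compression
                                    `[[q_in, c], [c, q_out]]` is hyperbolic).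

Pure linear algebra / real arithmetic ([folklore]; Schur complement: Haynsworth inertia, Mathlib
`Matrix.PosDef.fromBlocks₁₁`, `Matrix.det_fromBlocks₁₁`).  Which corner is the first indefinite
one for a given control is DATA (TABLE F).  Decls in `…PfPersistence.FlagPivot`.
-/

set_option linter.dupNamespace false  -- the mandated namespace repeats `RiemannHypothesis`

noncomputable section

open Matrix

namespace Summit.RiemannHypothesis.RiemannHypothesis.Theorems.PfPersistence.FlagPivot

variable {m : Type*} [Fintype m] [DecidableEq m]

/-- PROVED: a `Unit × Unit` real matrix is positive semidefinite iff its (only) entry is `≥ 0`.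
[folklore] -/
theorem posSemidef_unit_iff (D : Matrix Unit Unit ℝ) : D.PosSemidef ↔ 0 ≤ D () () := by
  have hD : D = diagonal (fun _ : Unit => D () ()) := by
    ext i j
    cases i; cases j
    simp
  constructor
  · intro h
    rw [hD] at h
    exact (posSemidef_diagonal_iff.mp h) ()
  · intro h
    rw [hD]
    exact posSemidef_diagonal_iff.mpr (fun _ => h)

/-- PROVED (flag pivot law, PSD half): for a positive definite corner `A`, the bordered matrix
`[[A, b], [bᵀ, c]]` is positive semidefinite iff its last `LDLᵀ` pivot — the scalar Schur complement
`c − bᵀ A⁻¹ b` — is `≥ 0`.  [folklore; Mathlib `Matrix.PosDef.fromBlocks₁₁`] -/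
theorem bordered_posSemidef_iff_pivot {A : Matrix m m ℝ} (hA : A.PosDef) (b : Matrix m Unit ℝ)
    (c : Matrix Unit Unit ℝ) :
    (fromBlocks A b bᵀ c).PosSemidef ↔ 0 ≤ (c - bᵀ * A⁻¹ * b) () () := by
  letI : Invertible A := hA.isUnit.invertible
  have hT : bᵀ = bᴴ := (conjTranspose_eq_transpose_of_trivial b).symm
  rw [hT, Matrix.PosDef.fromBlocks₁₁ b c hA, posSemidef_unit_iff]

/-- PROVED (flag pivot law, indefinite half): for a positive definite corner `A`, the bordered matrix
is NOT positive semidefinite — i.e. the next corner of the flag carries a negative direction — iff the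
pivot is `< 0`.  Given "corner `m` positive definite", "first negative pivot at index `m+1`" and
"corner `m+1` is the first indefinite corner" are therefore the same event (`N* = KF − 1`). [folklore] -/
theorem bordered_not_posSemidef_iff_pivot_neg {A : Matrix m m ℝ} (hA : A.PosDef) (b : Matrix m Unit ℝ)
    (c : Matrix Unit Unit ℝ) :
    ¬ (fromBlocks A b bᵀ c).PosSemidef ↔ (c - bᵀ * A⁻¹ * b) () () < 0 := by
  rw [bordered_posSemidef_iff_pivot hA b c, not_le]

/-- PROVED: the bordered determinant factors through the pivot,
`det [[A, b], [bᵀ, c]] = det A · (c − bᵀA⁻¹b) () ()`.  [folklore; Mathlib `Matrix.det_fromBlocks₁₁`] -/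
theorem bordered_det_eq {A : Matrix m m ℝ} (hA : A.PosDef) (b : Matrix m Unit ℝ)
    (c : Matrix Unit Unit ℝ) :
    (fromBlocks A b bᵀ c).det = A.det * (c - bᵀ * A⁻¹ * b) () () := by
  letI : Invertible A := hA.isUnit.invertible
  rw [det_fromBlocks₁₁, invOf_eq_nonsing_inv, det_unique (c - bᵀ * A⁻¹ * b)]

/-- PROVED: with `det A > 0` (automatic for a positive definite corner) the pivot is negative iff the
bordered determinant is negative — the sign test the LDLᵀ locator performs. [folklore] -/
theorem pivot_neg_iff_det_neg {A : Matrix m m ℝ} (hA : A.PosDef) (b : Matrix m Unit ℝ)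
    (c : Matrix Unit Unit ℝ) :
    (c - bᵀ * A⁻¹ * b) () () < 0 ↔ (fromBlocks A b bᵀ c).det < 0 := by
  have hdet : 0 < A.det := hA.det_pos
  rw [bordered_det_eq hA b c]
  constructor
  · exact fun h => mul_neg_of_pos_of_neg hdet h
  · intro h
    by_contra hle
    exact absurd h (not_lt.mpr (mul_nonneg hdet.le (not_lt.mp hle)))

/-- PROVED (cross-term law; the arithmetic of §9.5 (b)): if the inside and outside Rayleigh parts are
both `≥ 0` while the total `q_in + q_out + 2c` is `< 0`, then the cross term is negative and dominates
geometrically: `c < 0` and `q_in · q_out < c²` (the `2 × 2` compression `[[q_in, c], [c, q_out]]` has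
negative determinant).  [folklore] -/
theorem crossTerm_law (qin qout c : ℝ) (hin : 0 ≤ qin) (hout : 0 ≤ qout)
    (htot : qin + qout + 2 * c < 0) : c < 0 ∧ qin * qout < c ^ 2 := by
  have hc : c < 0 := by nlinarith
  refine ⟨hc, ?_⟩
  -- AM–GM: qin * qout ≤ ((qin + qout)/2)² < c²  since 0 ≤ qin + qout < −2c
  have hs : qin + qout < -2 * c := by linarith
  have hsq : (qin + qout) ^ 2 < (2 * c) ^ 2 := by nlinarith
  nlinarith [sq_nonneg (qin - qout)]

end Summit.RiemannHypothesis.RiemannHypothesis.Theorems.PfPersistence.FlagPivot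

end
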